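import Summits.HodgeConjecture.CorCM.Census.CyclicCharacterArcType
import Summits.HodgeConjecture.CorCM.Census.BaseBlockNearTypes
import Summits.HodgeConjecture.CorCM.Census.NondegenerateReduction

/-!
# Cyclic characters, VII: THE ARC BLOCK IS AS GOOD AS A NONDEGENERATE BASE TYPE — Hodge vectors on the arc block are sums of pairs, so a complete
# reduction onto the arc block generates up to the same power of `2`

COR-CM (cell `pub-hodgecm2`), count-neutral kernel combinatorics by the binder seat b09 (gen 41; lane CYCLIC-CHARACTER FIBRE LAW, part IX), on part VII
(`Census/CyclicCharacterArcType.lean`), gen 38ʼs META pieces (`Census/NondegenerateReduction.lean`: `typeSum_sum_baseVec`, `reduction_of_residual`;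
`Census/BaseBlockNearTypes.lean`: `residual_reduction_of_single_flips`; `Census/BaseBlockCovering.lean`: `exists_cover_residual`) BY NAME.  Theorems only (no
definition, no `decide`, no certificate, no named fact, no `sorry`).
HONEST FRAMING: `HC_CM` is NOT proved, here or anywhere in the tree; nothing here is a period or a headline.

THE POINT.  Gen 38ʼs META theorem reduces `μ(G,c) = φ₂(G,c)` to a complete reduction of the residual types onto a base type `T₀` up to `2ᵏ` — but its last
step (`Nondegenerate.two_pow_smul_mem_of_reduction`) needs `T₀` KUBOTA-NONDEGENERATE, and the arc type `T_0 = w⁻¹(arc)` of the cyclic-character class is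
DEGENERATE (its stabiliser is `ker w`).  This file replaces nondegeneracy by the WINDOW ARGUMENT: the type sum of `Σ_Q a_Q [T_0·Q⁻¹] = Σ_u A_u [T_{−u}]`
(`A_u = Σ_{w Q = u} a_Q`) at a point `x` is the window sum `Σ_{j ∈ arc} A_{−(w x) − j}`… constancy of the window sums forces `A` to be `2ᵏ⁻¹`-PERIODIC, and then
the combination is symmetric under conjugation (`T̄_b = T_{b + 2ᵏ⁻¹}`), i.e. a sum of pairs.

* §1 **symmetric vectors are sums of pairs** (`mem_span_pairSet_of_symm`, any central involution): `y(Ψ̄) = y(Ψ)` for all `Ψ` ⇒ `y ∈ ℤ⟨pairs⟩`.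
* §2 the window step (`indicator_step`) and **periodicity of the fibre sums of a Hodge combination of arc types** (`fibreSum_periodic`).
* §3 **A HODGE COMBINATION OF ARC TYPES IS A SUM OF PAIRS** (`sum_baseVec_arcType_mem_span_pairSet_of_mem_hodgeSpan`) — gen 38ʼs
  `sum_baseVec_mem_span_pairSet_of_mem_hodgeSpan` WITHOUT the nondegeneracy hypothesis, for `T₀ = T_0`.
* §4 **THE ARC REDUCTION THEOREM** (`two_pow_smul_mem_of_arc_reduction`, `two_pow_smul_mem_psp_of_arc_reduction`): `ℤ⟨pairs⟩ ≤ L ≤ hodgeSpan` and every type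
  `≡ ℤ[G]·[T_0]` modulo `L` up to `2ʲ` ⇒ `2ʲ·hodgeSpan ≤ L`; and the SINGLE-FLIP FORM (`two_pow_smul_mem_psp_of_single_flips`): with gen 38ʼs cover of `T_0` inside `S`,
  it suffices that the `|G|/2` single flips `T_0^{(s)}` reduce — exactly the «closing faces» of the road map (`HOME/pub-hodgecm2-b09/lean-g41/METACYCLIC-ROADMAP.md`:
  numerically `2ᵏ⁻¹ − 1 + d` faces do it in every row, e.g. `ℤ/3 ⋊ ℤ/8`: 4).  With `Splitting.isLeast_card_gfaces_generate_of_isPGroup` (2-groups) or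
  `…_of_isPGroup_rel` (odd kernel) this is the META route to `μ = φ₂` for the whole class.

## References
* [Pohlmann1968] H. Pohlmann, Algebraic cycles on abelian varieties of complex multiplication type, Ann. of Math. 88 (1968), Thm 1.
* [Milne1999] J. S. Milne, Lefschetz motives and the Tate conjecture, Compositio Math. 117 (1999), Prop. 2.1, p. 54.
-/

namespace Summit.HodgeConjecture.CorCM.Census.CyclicCharacter

open Finset
open Summit.HodgeConjecture.CorCM.Prior.AllgGroup.RfwfAllgGroup
open Summit.HodgeConjecture.CorCM.Census.BlockParity
open Summit.HodgeConjecture.CorCM.Census.Coinvariant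
open Summit.HodgeConjecture.CorCM.Census.TypeStabiliser
open Summit.HodgeConjecture.CorCM.Census.TwistGeneration
open Summit.HodgeConjecture.CorCM.Census.Nondegenerate
open Summit.HodgeConjecture.CorCM.Census.BaseBlock

noncomputable section

variable {G : Type*} [Group G] [Fintype G] [DecidableEq G] {k : ℕ} {w : G → ZMod (2 ^ k)} {c : G}

/-! ## §1 Symmetric vectors are sums of pairs -/

/-- **A conjugation-symmetric vector is a sum of pairs**: if `y (Ψ·c) = y Ψ` for every type then `y ∈ ℤ⟨pairs⟩` (central involution `c ≠ 1`).
Proof: `2y = Σ_Ψ y(Ψ)·pair(Ψ)`… no — directly `y = Σ_{Ψ ∋ 1} y(Ψ)·pair(Ψ)`, the types containing `1` being a transversal of conjugation. [folklore] -/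
theorem mem_span_pairSet_of_symm [Fintype (CMF G c)] (hc2 : c * c = 1) (y : CMF G c →₀ ℤ) (hy : ∀ Ψ : CMF G c, y (rt c c Ψ) = y Ψ) :
    y ∈ Submodule.span ℤ (pairSet c) := by
  classical
  have h1 : ∀ Ψ : CMF G c, (1 : G) ∈ (rt c c Ψ).1 ↔ (1 : G) ∉ Ψ.1 := by
    intro Ψ
    have h0 : (1 : G) ∈ Ψ.1 ↔ c ∉ Ψ.1 := by simpa only [mul_one] using Ψ.2 1
    rw [mem_rt, one_mul]
    constructor
    · intro hc hone
      exact (h0.mp hone) hc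
    · intro hone
      by_contra hc
      exact hone (h0.mpr hc)
  have hswap : ∀ (Φ Ψ : CMF G c), (rt c c Ψ = Φ) ↔ (Ψ = rt c c Φ) := fun Φ Ψ =>
    ⟨fun h => by rw [← h, rt_self_rt_self c hc2], fun h => by rw [h, rt_self_rt_self c hc2]⟩
  -- the transversal: types containing `1`
  have key : y = ∑ Ψ ∈ (univ : Finset (CMF G c)).filter (fun Ψ => (1 : G) ∈ Ψ.1), y Ψ • pair c Ψ := by
    ext Φ
    rw [Finsupp.finsetSum_apply]
    simp only [Finsupp.smul_apply, pair, Finsupp.add_apply, Finsupp.single_apply, smul_eq_mul, mul_add, mul_ite, mul_one, mul_zero,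
      Finset.sum_add_distrib, hswap Φ, Finset.sum_ite_eq', mem_filter, mem_univ, true_and, hy, h1 Φ]
    by_cases hΦ : (1 : G) ∈ Φ.1
    · rw [if_pos hΦ, if_neg (not_not.mpr hΦ), add_zero]
    · rw [if_neg hΦ, if_pos hΦ, zero_add]
  rw [key]
  exact Submodule.sum_mem _ fun Ψ _ => Submodule.smul_mem _ _ (Submodule.subset_span (pair_mem_pairSet c Ψ))

/-! ## §2 The window step and the periodicity of the fibre sums -/

omit [Fintype G] [DecidableEq G] in
/-- **The window step**: `[u ∈ arc] − [u − 1 ∈ arc] = [u = 0] − [u = 2ᵏ⁻¹]` (`arc = [0, 2ᵏ⁻¹)`, `k ≥ 1`). [folklore] -/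
theorem indicator_step (hk : 1 ≤ k) (u : ZMod (2 ^ k)) :
    ((if u.val < 2 ^ (k - 1) then (1 : ℤ) else 0) - if (u - 1).val < 2 ^ (k - 1) then (1 : ℤ) else 0) =
      (if u = 0 then (1 : ℤ) else 0) - if u = ((2 ^ (k - 1) : ℕ) : ZMod (2 ^ k)) then (1 : ℤ) else 0 := by
  haveI : NeZero (2 ^ k) := ⟨pow_ne_zero _ two_ne_zero⟩
  haveI : Fact (1 < 2 ^ k) := ⟨Nat.one_lt_two_pow (by omega)⟩
  have h2k : 2 ^ k = 2 * 2 ^ (k - 1) := by rw [← pow_succ', Nat.sub_add_cancel hk]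
  have hH : (((2 ^ (k - 1) : ℕ) : ZMod (2 ^ k))).val = 2 ^ (k - 1) := val_two_pow_pred hk
  by_cases hu : u = 0
  · subst hu
    have hv : ((0 : ZMod (2 ^ k)) - 1).val = 2 ^ k - 1 := by
      rw [zero_sub, ZMod.neg_val, if_neg one_ne_zero, ZMod.val_one]
    have hne : (0 : ZMod (2 ^ k)) ≠ ((2 ^ (k - 1) : ℕ) : ZMod (2 ^ k)) := by
      intro h
      have := congrArg ZMod.val h
      rw [ZMod.val_zero, hH] at this
      have := Nat.one_le_two_pow (n := k - 1)
      omega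
    have hpos : 0 < 2 ^ (k - 1) := Nat.pos_of_ne_zero (pow_ne_zero _ two_ne_zero)
    rw [ZMod.val_zero, hv, if_pos hpos, if_neg (by omega), if_pos rfl, if_neg hne]
  · have hu1 : 1 ≤ u.val := Nat.one_le_iff_ne_zero.mpr fun h => hu ((ZMod.val_eq_zero u).mp h)
    have hv : (u - 1).val = u.val - 1 := by
      rw [ZMod.val_sub (by rw [ZMod.val_one]; exact hu1), ZMod.val_one]
    rw [hv, if_neg hu]
    by_cases hH' : u = ((2 ^ (k - 1) : ℕ) : ZMod (2 ^ k))
    · have : u.val = 2 ^ (k - 1) := by rw [hH', hH]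
      rw [if_pos hH', if_neg (by omega), if_pos (by omega)]
    · have : u.val ≠ 2 ^ (k - 1) := fun h => hH' (by rw [← ZMod.natCast_zmod_val u, h])
      rw [if_neg hH']
      by_cases hlt : u.val < 2 ^ (k - 1)
      · rw [if_pos hlt, if_pos (by omega)]
        norm_num
      · rw [if_neg hlt, if_neg (by omega)]

/-- The type sum of a combination of base changes of the arc type `T_0` at `x`, as a window sum over the values of `w`. [folklore] -/
theorem typeSum_sum_baseVec_arcType (hw : ∀ P Q : G, w (P * Q) = w P + w Q) (hk : 1 ≤ k) (hc2 : c * c = 1) (hwc : w c ≠ 0) (a : G → ℤ) (x : G) :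
    typeSum G c (∑ Q, a Q • Finsupp.single (rt c Q (arcType hw hk hc2 hwc 0)) (1 : ℤ)) x =
      ∑ Q, a Q * (if (w x + w Q).val < 2 ^ (k - 1) then (1 : ℤ) else 0) := by
  rw [typeSum_sum_baseVec]
  refine Finset.sum_congr rfl fun Q _ => ?_
  congr 1
  unfold indG
  simp only [mem_arcType, hw, sub_zero]

omit [Group G] [DecidableEq G] in
/-- **The window difference is a difference of two fibre sums**: with `W(v) = Σ_Q a_Q [v + w Q ∈ arc]`,
`W(v) − W(v − 1) = A(−v) − A(2ᵏ⁻¹ − v)`, `A(u) = Σ_{w Q = u} a_Q`. [folklore] -/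
theorem window_diff (hk : 1 ≤ k) (a : G → ℤ) (v : ZMod (2 ^ k)) :
    (∑ Q, a Q * (if (v + w Q).val < 2 ^ (k - 1) then (1 : ℤ) else 0)) -
      (∑ Q, a Q * (if (v - 1 + w Q).val < 2 ^ (k - 1) then (1 : ℤ) else 0)) =
      (∑ Q, if w Q = -v then a Q else 0) - ∑ Q, if w Q = ((2 ^ (k - 1) : ℕ) : ZMod (2 ^ k)) - v then a Q else 0 := by
  rw [← Finset.sum_sub_distrib, ← Finset.sum_sub_distrib]
  refine Finset.sum_congr rfl fun Q _ => ?_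
  rw [← mul_sub, show v - 1 + w Q = (v + w Q) - 1 by abel, indicator_step hk (v + w Q), mul_sub]
  congr 1
  · rw [mul_ite, mul_one, mul_zero]
    congr 1
    exact propext ⟨fun h => eq_neg_of_add_eq_zero_right h, fun h => by rw [h, add_neg_cancel]⟩
  · rw [mul_ite, mul_one, mul_zero]
    congr 1
    exact propext ⟨fun h => by rw [← h]; abel, fun h => by rw [h]; abel⟩

/-- **PERIODICITY of the fibre sums of a Hodge combination of arc types**: if `Σ_Q a_Q [T_0·Q⁻¹]` has constant type sum and `w` is onto, then
`A(u) = A(u + 2ᵏ⁻¹)` for every `u`, `A(u) = Σ_{w Q = u} a_Q`. [folklore] -/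
theorem fibreSum_periodic (hw : ∀ P Q : G, w (P * Q) = w P + w Q) (hk : 1 ≤ k) (hc2 : c * c = 1) (hwc : w c ≠ 0) (h1 : ∃ g₁ : G, w g₁ = 1)
    (a : G → ℤ) {K : ℤ} (hK : ∀ x, typeSum G c (∑ Q, a Q • Finsupp.single (rt c Q (arcType hw hk hc2 hwc 0)) (1 : ℤ)) x = K) (u : ZMod (2 ^ k)) :
    (∑ Q, if w Q = u then a Q else 0) = ∑ Q, if w Q = u + ((2 ^ (k - 1) : ℕ) : ZMod (2 ^ k)) then a Q else 0 := by
  -- window sums are constant in `v`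
  have hW : ∀ v : ZMod (2 ^ k), (∑ Q, a Q * (if (v + w Q).val < 2 ^ (k - 1) then (1 : ℤ) else 0)) = K := by
    intro v
    obtain ⟨x, hx⟩ := exists_apply_eq hw h1 v
    rw [← hx, ← typeSum_sum_baseVec_arcType hw hk hc2 hwc a x]
    exact hK x
  have hd := window_diff (w := w) hk a (-u)
  rw [hW, hW, sub_self, neg_neg] at hd
  have e : ((2 ^ (k - 1) : ℕ) : ZMod (2 ^ k)) - -u = u + ((2 ^ (k - 1) : ℕ) : ZMod (2 ^ k)) := by abel
  rw [e] at hd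
  exact (sub_eq_zero.mp hd.symm)

/-! ## §3 A Hodge combination of arc types is a sum of pairs -/

/-- The coefficient of `Σ_Q a_Q [T_0·Q⁻¹]` at the arc type `T_b` is the fibre sum `A(−b)`. [folklore] -/
theorem sum_baseVec_arcType_apply (hw : ∀ P Q : G, w (P * Q) = w P + w Q) (hk : 1 ≤ k) (hc2 : c * c = 1) (hwc : w c ≠ 0) (h1 : ∃ g₁ : G, w g₁ = 1)
    (a : G → ℤ) (b : ZMod (2 ^ k)) :
    (∑ Q, a Q • Finsupp.single (rt c Q (arcType hw hk hc2 hwc 0)) (1 : ℤ)) (arcType hw hk hc2 hwc b) = ∑ Q, if w Q = -b then a Q else 0 := by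
  rw [Finsupp.finsetSum_apply]
  refine Finset.sum_congr rfl fun Q _ => ?_
  rw [Finsupp.smul_apply, rt_arcType, zero_sub, smul_eq_mul, Finsupp.single_apply]
  by_cases h : w Q = -b
  · rw [if_pos h, if_pos (by rw [h, neg_neg]), mul_one]
  · rw [if_neg h, if_neg (fun e => h (neg_eq_iff_eq_neg.mp (arcType_injective hw hk hc2 hwc h1 e))), mul_zero]

/-- Outside the arc block the combination vanishes. [folklore] -/
theorem sum_baseVec_arcType_apply_eq_zero (hw : ∀ P Q : G, w (P * Q) = w P + w Q) (hk : 1 ≤ k) (hc2 : c * c = 1) (hwc : w c ≠ 0)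
    (a : G → ℤ) {Φ : CMF G c} (hΦ : ∀ b : ZMod (2 ^ k), Φ ≠ arcType hw hk hc2 hwc b) :
    (∑ Q, a Q • Finsupp.single (rt c Q (arcType hw hk hc2 hwc 0)) (1 : ℤ)) Φ = 0 := by
  rw [Finsupp.finsetSum_apply]
  refine Finset.sum_eq_zero fun Q _ => ?_
  rw [Finsupp.smul_apply, rt_arcType, Finsupp.single_apply, if_neg (fun h => hΦ _ h.symm), smul_zero]

/-- **A HODGE COMBINATION OF ARC TYPES IS A SUM OF PAIRS** — the arc block replaces a nondegenerate base type (`w` onto, `c ≠ 1` central). [folklore] -/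
theorem sum_baseVec_arcType_mem_span_pairSet_of_mem_hodgeSpan [Fintype (CMF G c)] (hw : ∀ P Q : G, w (P * Q) = w P + w Q) (hk : 1 ≤ k)
    (hc2 : c * c = 1) (hcen : ∀ x : G, x * c = c * x) (hwc : w c ≠ 0) (h1 : ∃ g₁ : G, w g₁ = 1) (a : G → ℤ)
    (ha : (∑ Q, a Q • Finsupp.single (rt c Q (arcType hw hk hc2 hwc 0)) (1 : ℤ)) ∈ hodgeSpan c hc2) :
    (∑ Q, a Q • Finsupp.single (rt c Q (arcType hw hk hc2 hwc 0)) (1 : ℤ)) ∈ Submodule.span ℤ (pairSet c) := by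
  obtain ⟨K, hK⟩ := exists_forall_typeSum_eq_of_mem_hodgeSpan c hc2 hcen ha
  refine mem_span_pairSet_of_symm hc2 _ fun Ψ => ?_
  by_cases hΨ : ∃ b : ZMod (2 ^ k), Ψ = arcType hw hk hc2 hwc b
  · obtain ⟨b, rfl⟩ := hΨ
    rw [rt_self_arcType, sum_baseVec_arcType_apply hw hk hc2 hwc h1, sum_baseVec_arcType_apply hw hk hc2 hwc h1,
      fibreSum_periodic hw hk hc2 hwc h1 a hK (-(b + ((2 ^ (k - 1) : ℕ) : ZMod (2 ^ k))))]
    simp only [show -(b + ((2 ^ (k - 1) : ℕ) : ZMod (2 ^ k))) + ((2 ^ (k - 1) : ℕ) : ZMod (2 ^ k)) = -b by abel]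
  · push Not at hΨ
    have hΨ' : ∀ b : ZMod (2 ^ k), rt c c Ψ ≠ arcType hw hk hc2 hwc b := by
      intro b h
      apply hΨ (b + ((2 ^ (k - 1) : ℕ) : ZMod (2 ^ k)))
      rw [← rt_self_arcType, ← h, rt_self_rt_self c hc2]
    rw [sum_baseVec_arcType_apply_eq_zero hw hk hc2 hwc a hΨ', sum_baseVec_arcType_apply_eq_zero hw hk hc2 hwc a hΨ]

/-! ## §4 THE ARC REDUCTION THEOREM -/

/-- **THE ARC REDUCTION THEOREM.**  `ℤ⟨pairs⟩ ≤ L ≤ hodgeSpan`, every type reduces to the base changes of the arc type `T_0` modulo `L` up to `2ʲ`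
`⟹ 2ʲ · hodgeSpan ≤ L` — gen 38ʼs `Nondegenerate.two_pow_smul_mem_of_reduction` for the DEGENERATE arc type. [folklore] -/
theorem two_pow_smul_mem_of_arc_reduction [Fintype (CMF G c)] (hw : ∀ P Q : G, w (P * Q) = w P + w Q) (hk : 1 ≤ k) (hc2 : c * c = 1)
    (hcen : ∀ x : G, x * c = c * x) (hwc : w c ≠ 0) (h1 : ∃ g₁ : G, w g₁ = 1)
    (L : Submodule ℤ (CMF G c →₀ ℤ)) (hPL : Submodule.span ℤ (pairSet c) ≤ L) (hLH : L ≤ hodgeSpan c hc2) (j : ℕ)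
    (hred : ∀ Φ : CMF G c, ((2 : ℤ) ^ j) • Finsupp.single Φ (1 : ℤ) ∈
      L ⊔ Submodule.span ℤ (Set.range fun Q : G => Finsupp.single (rt c Q (arcType hw hk hc2 hwc 0)) (1 : ℤ)))
    {y : CMF G c →₀ ℤ} (hy : y ∈ hodgeSpan c hc2) : ((2 : ℤ) ^ j) • y ∈ L := by
  obtain ⟨l, hl, b, hb, hsum⟩ := Submodule.mem_sup.mp (two_pow_smul_mem_sup_of_forall_single c (arcType hw hk hc2 hwc 0) L j hred y)
  obtain ⟨a, rfl⟩ := (Submodule.mem_span_range_iff_exists_fun ℤ).mp hb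
  have hbH : (∑ Q, a Q • Finsupp.single (rt c Q (arcType hw hk hc2 hwc 0)) (1 : ℤ)) ∈ hodgeSpan c hc2 := by
    have e : (∑ Q, a Q • Finsupp.single (rt c Q (arcType hw hk hc2 hwc 0)) (1 : ℤ)) = ((2 : ℤ) ^ j) • y - l := by rw [← hsum]; abel
    rw [e]
    exact Submodule.sub_mem _ (Submodule.smul_mem _ _ hy) (hLH hl)
  rw [← hsum]
  exact Submodule.add_mem _ hl (hPL (sum_baseVec_arcType_mem_span_pairSet_of_mem_hodgeSpan hw hk hc2 hcen hwc h1 a hbH))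

/-- **Packaged: reduction onto the arc block modulo `ℤ⟨pairs⟩ + ℤ⟨base changes of S⟩` generates up to `2ʲ`** — the `htwo` hypothesis of
`Splitting.isLeast_card_gfaces_generate_of_isPGroup(_rel)` and of `Splitting.hodgeSpan_le_of_cover_of_supported`. [folklore] -/
theorem two_pow_smul_mem_psp_of_arc_reduction [Fintype (CMF G c)] (hw : ∀ P Q : G, w (P * Q) = w P + w Q) (hk : 1 ≤ k) (hc2 : c * c = 1)
    (hcen : ∀ x : G, x * c = c * x) (hwc : w c ≠ 0) (h1 : ∃ g₁ : G, w g₁ = 1)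
    (S : Finset (CMF G c →₀ ℤ)) (hS : (↑S : Set (CMF G c →₀ ℤ)) ⊆ hodgeSpan c hc2) (j : ℕ)
    (hred : ∀ Φ : CMF G c, ((2 : ℤ) ^ j) • Finsupp.single Φ (1 : ℤ) ∈
      (Submodule.span ℤ (pairSet c) ⊔ Submodule.span ℤ (translates c S)) ⊔
        Submodule.span ℤ (Set.range fun Q : G => Finsupp.single (rt c Q (arcType hw hk hc2 hwc 0)) (1 : ℤ))) :
    ∀ y ∈ hodgeSpan c hc2, ((2 : ℤ) ^ j) • y ∈ Submodule.span ℤ (pairSet c) ⊔ Submodule.span ℤ (translates c S) := by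
  intro y hy
  refine two_pow_smul_mem_of_arc_reduction hw hk hc2 hcen hwc h1 _ le_sup_left ?_ j hred hy
  refine sup_le (Submodule.span_le.mpr fun _ ⟨Ψ, h⟩ => h ▸ pair_mem_hodgeSpan c hc2 Ψ) (Submodule.span_le.mpr ?_)
  rintro _ ⟨Q, s, hs, rfl⟩
  exact mapDomain_rt_mem_hodgeSpan c hc2 hcen Q (hS (Finset.mem_coe.mpr hs))

/-- **THE SINGLE-FLIP FORM.**  If `S ⊆ hodgeSpan` contains (the base changes of) gen 38ʼs COVER of the arc type `T_0` — i.e. every type reduces INTEGRALLY to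
the residual types `bpot ≤ 1` modulo `ℤ⟨pairs⟩ + ℤ[G]·S` — and every SINGLE FLIP `T_0^{(s)}` (`s ∈ T_0`) reduces to the arc block up to `2ʲ`, then
`2ʲ · hodgeSpan ≤ ℤ⟨pairs⟩ + ℤ[G]·S`.  (The cover exists for every `S ⊇` `BaseBlock.exists_cover_residual`; the single-flip reductions are the columnʼs
«closing faces».) [folklore] -/
theorem two_pow_smul_mem_psp_of_single_flips [Fintype (CMF G c)] (hw : ∀ P Q : G, w (P * Q) = w P + w Q) (hk : 1 ≤ k) (hc2 : c * c = 1)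
    (hcen : ∀ x : G, x * c = c * x) (hwc : w c ≠ 0) (h1 : ∃ g₁ : G, w g₁ = 1)
    (S : Finset (CMF G c →₀ ℤ)) (hS : (↑S : Set (CMF G c →₀ ℤ)) ⊆ hodgeSpan c hc2) (j : ℕ)
    (hcov : ∀ Φ : CMF G c, Finsupp.single Φ (1 : ℤ) ∈
      (Submodule.span ℤ (pairSet c) ⊔ Submodule.span ℤ (translates c S)) ⊔
        Submodule.span ℤ ((fun Ψ => Finsupp.single Ψ (1 : ℤ)) '' {Ψ : CMF G c | bpot c (arcType hw hk hc2 hwc 0) Ψ ≤ 1}))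
    (hflip : ∀ s ∈ (arcType hw hk hc2 hwc 0).1, ((2 : ℤ) ^ j) • Finsupp.single (oflipCM c hc2 s (arcType hw hk hc2 hwc 0)) (1 : ℤ) ∈
      (Submodule.span ℤ (pairSet c) ⊔ Submodule.span ℤ (translates c S)) ⊔
        Submodule.span ℤ (Set.range fun Q : G => Finsupp.single (rt c Q (arcType hw hk hc2 hwc 0)) (1 : ℤ))) :
    ∀ y ∈ hodgeSpan c hc2, ((2 : ℤ) ^ j) • y ∈ Submodule.span ℤ (pairSet c) ⊔ Submodule.span ℤ (translates c S) := by
  refine two_pow_smul_mem_psp_of_arc_reduction hw hk hc2 hcen hwc h1 S hS j fun Φ => ?_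
  exact reduction_of_residual c (arcType hw hk hc2 hwc 0) _ {Ψ : CMF G c | bpot c (arcType hw hk hc2 hwc 0) Ψ ≤ 1} j hcov
    (fun Ψ hΨ => residual_reduction_of_single_flips c (arcType hw hk hc2 hwc 0) hc2 hcen S j hflip Ψ hΨ) Φ

end

end Summit.HodgeConjecture.CorCM.Census.CyclicCharacter
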